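import Mathlib.LinearAlgebra.Matrix.NonsingularInverse
import Literature.Computability.Cryptography.LWEProductLaws
import HarnessLib

/-!
# First-is-errorless LWE (BLPRS 2013, Def. 4.2) and the reduction of Lemma 4.3, as exact laws

Topic `Computability/Cryptography` (LWE), grouping namespace `LWE` (the model of
`Literature/Computability/Cryptography/LWE.lean`). Proved material (no named fact is introduced)
towards the named fact `Literature.Computability.Cryptography.blprs_gapSVP_sqrt_dim_to_lwe_classical`
(**pqc.S21**; Brakerski–Langlois–Peikert–Regev–Stehlé, *Classical hardness of learning with
errors*, STOC 2013, Thm. 1.1). The binary-secret theorem of that paper (Thm. 4.1) is proved by a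
chain of four transformation reductions (§4, "In a high level, the proof of the theorem follows by
combining three main steps" + the trivial one); this file formalises the FIRST of them, §4.1:

> **Definition 4.2** (first-is-errorless LWE). Distinguish (i) a first sample uniform over
> `𝕋_qⁿ × 𝕋_q` and the rest uniform over `𝕋_qⁿ × 𝕋`, from (ii) an unknown uniform `s`, a first
> sample from `A_{q,s,{0}}` (errorless) and the rest from `A_{q,s,φ}`.
>
> **Lemma 4.3.** For any `n ≥ 2`, `m, q ≥ 1` and error distribution `φ`, there is an efficient
> (transformation) reduction from `LWE_{n-1,m,q,φ}` to the first-is-errorless variant of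
> `LWE_{n,m,q,φ}` that reduces the advantage by at most `∑_{p | q prime} p^{-n}`.

in the tree's discrete model (samples in `ℤ_qⁿ × ℤ_q`, noise law `χ : PMF ℤ_q`; stated over any finite
commutative ring `R`, dimension `k + 1`, written `n = k + 1`). The printed reduction: choose `a'`
uniformly; abort unless `a'` extends to a matrix `U` invertible modulo `q` with leftmost column `a'`;
pick `s₀` uniformly; output the first sample `(a', s₀)`; map every given sample `(a, b)`, with a fresh
uniform `d`, to `(U(d|a), b + s₀ d)`. Printed correctness: uniform samples go to uniform samples,
and samples of `A_{s,φ}` go to one sample of `A_{s',{0}}` followed by samples of `A_{s',φ}` with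
`s' = (U⁻¹)ᵀ(s₀|s)` uniform ("`U`, being invertible modulo `q`, induces a bijection").

## Results (all exact identities of `PMF`s, or the elementary advantage accounting)

* `felSamples χ s m`, `felSamplesUniformSecret χ m` (scenario (ii)), `felUniform k m` (scenario (i)),
  `felAdvantage χ m D` — Def. 4.2 with `1 + m` samples (one errorless sample, then `m` samples);
* `felSampleMap U s₀ (d, (a, b)) = (U(d|a), b + d s₀)`, `felSecret U s₀ s = (U⁻¹)ᵀ (s₀|s)`;
* `pairLaw_lweSample_map_felSampleMap` — **`A_{s,χ}` with a fresh uniform `d` goes to `A_{s',χ}`**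
  (`U` invertible); `pairLaw_uniform_map_felSampleMap` — **uniform goes to uniform**;
* `felCoinsMap`, `iidPMF_bind_felCoinsMap` — the per-sample map with independent fresh coins on an
  iid tuple is the iid tuple of the mapped pair law; block forms `lweSamples_bind_felCoinsMap`,
  `uniformSamples_bind_felCoinsMap`;
* (sibling file `LWEFirstIsErrorlessReduction.lean`) the whole reduction as a Markov kernel
  `felTransform Good cpl m` with the printed abort, its output laws in the two worlds, and Lemma 4.3's
  advantage accounting `felAdvantage_le`; (sibling files `LWEFirstIsErrorlessZMod.lean`,
  `UnimodularCompletion.lean`) the bound `Pr[abort] ≤ ∑_{p | q} p^{-(k+1)}` over `ℤ_q` and the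
  existence of the completion (extended GCD).

## References

* Z. Brakerski, A. Langlois, C. Peikert, O. Regev, D. Stehlé, *Classical hardness of learning with
  errors*, STOC 2013, 575–584; arXiv:1306.0281, §4.1, Def. 4.2 and Lemma 4.3 with its proof.
* O. Regev, *On lattices, learning with errors, …*, J. ACM 56 (2009), §4 (the model `A_{s,χ}`).
-/

noncomputable section

open scoped ENNReal
open Matrix

namespace Literature.Computability.Cryptography

namespace LWE

open Literature.Probability.Distributions

variable {R : Type} [CommRing R]

/-! ### Definition 4.2: the first-is-errorless distributions and the advantage -/

section Def42

variable [Fintype R] {k : ℕ}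

/-- Scenario (ii) of BLPRS Def. 4.2 for a FIXED secret `s ∈ Rⁿ` (`n = k+1` free here: any `n`):
the errorless first sample `(a₁, ⟨a₁, s⟩)` with `a₁` uniform, independent of `m` further samples of
`A_{s,χ}`. [cite: BrakerskiEtAl2013, Def. 4.2] -/
def felSamples {n : ℕ} (χ : PMF R) (s : Fin n → R) (m : ℕ) :
    PMF (((Fin n → R) × R) × (Fin m → (Fin n → R) × R)) :=
  prodLaw ((PMF.uniformOfFintype (Fin n → R)).map fun a => (a, a ⬝ᵥ s)) (lweSamples χ s m)

/-- Scenario (ii) of BLPRS Def. 4.2: "there is an unknown uniformly distributed `s`, the first sample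
we get is from `A_{q,s,{0}}` and the rest are from `A_{q,s,φ}`" (`1 + m` samples).
[cite: BrakerskiEtAl2013, Def. 4.2] -/
def felSamplesUniformSecret {n : ℕ} (χ : PMF R) (m : ℕ) :
    PMF (((Fin n → R) × R) × (Fin m → (Fin n → R) × R)) :=
  (PMF.uniformOfFintype (Fin n → R)).bind fun s => felSamples χ s m

variable (R) in
/-- Scenario (i) of BLPRS Def. 4.2: "the first sample is uniform over `𝕋_qⁿ × 𝕋_q` and the rest are
uniform over `𝕋_qⁿ × 𝕋`" — in the discrete model, the uniform law on all `1 + m` samples.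
[cite: BrakerskiEtAl2013, Def. 4.2] -/
def felUniform (n m : ℕ) : PMF (((Fin n → R) × R) × (Fin m → (Fin n → R) × R)) :=
  PMF.uniformOfFintype _

/-- The advantage of a distinguisher `D` on the first-is-errorless problem (Def. 4.2, with the
paper's `Adv[𝒜] = |Pr[𝒜(P₀)] - Pr[𝒜(P₁)]|`, §2). [cite: BrakerskiEtAl2013, Def. 4.2] -/
def felAdvantage {n : ℕ} (χ : PMF R) (m : ℕ)
    (D : ((Fin n → R) × R) × (Fin m → (Fin n → R) × R) → PMF Bool) : ℝ :=
  |(acceptProb D (felSamplesUniformSecret χ m)).toReal - (acceptProb D (felUniform R n m)).toReal|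

end Def42

/-! ### The sample map of Lemma 4.3 and the new secret -/

section SampleMap

variable {k : ℕ}

/-- The per-sample map of the reduction of Lemma 4.3 for a completion `U` of the first vector and the
scalar `s₀`: `(d, (a, b)) ↦ (U(d|a), b + d·s₀)` (`d` the fresh uniform coin of this sample; `(d|a)`
is `vecCons d a`). [cite: BrakerskiEtAl2013, Lemma 4.3 (proof)] -/
def felSampleMap (U : Matrix (Fin (k + 1)) (Fin (k + 1)) R) (s₀ : R) (y : R × ((Fin k → R) × R)) :
    (Fin (k + 1) → R) × R :=
  (U *ᵥ vecCons y.1 y.2.1, y.2.2 + y.1 * s₀)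

/-- The secret of the transformed samples: `s' = (U⁻¹)ᵀ (s₀|s)`. [cite: BrakerskiEtAl2013, Lemma 4.3 (proof)] -/
def felSecret (U : Matrix (Fin (k + 1)) (Fin (k + 1)) R) (s₀ : R) (s : Fin k → R) : Fin (k + 1) → R :=
  (U⁻¹)ᵀ *ᵥ vecCons s₀ s

/-- `⟨U v, (U⁻¹)ᵀ w⟩ = ⟨v, w⟩` for `U` invertible. [folklore] -/
theorem mulVec_dotProduct_felSecret_aux {U : Matrix (Fin (k + 1)) (Fin (k + 1)) R} (hU : IsUnit U.det)
    (v w : Fin (k + 1) → R) : (U *ᵥ v) ⬝ᵥ ((U⁻¹)ᵀ *ᵥ w) = v ⬝ᵥ w := by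
  rw [mulVec_transpose, dotProduct_comm, ← dotProduct_mulVec, mulVec_mulVec, nonsing_inv_mul U hU,
    one_mulVec, dotProduct_comm]

/-- The transformed sample is an `A_{s',χ}`-sample: `⟨U(d|a), s'⟩ = d s₀ + ⟨a, s⟩`.
[cite: BrakerskiEtAl2013, Lemma 4.3 (proof)] -/
theorem mulVec_vecCons_dotProduct_felSecret {U : Matrix (Fin (k + 1)) (Fin (k + 1)) R} (hU : IsUnit U.det)
    (s₀ d : R) (s a : Fin k → R) :
    (U *ᵥ vecCons d a) ⬝ᵥ felSecret U s₀ s = d * s₀ + a ⬝ᵥ s := by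
  rw [felSecret, mulVec_dotProduct_felSecret_aux hU, cons_dotProduct_cons]

/-- The first sample is errorless for the new secret: if the leftmost column of `U` is `a'` then
`⟨a', s'⟩ = s₀`. [cite: BrakerskiEtAl2013, Lemma 4.3 (proof)] -/
theorem col_dotProduct_felSecret {U : Matrix (Fin (k + 1)) (Fin (k + 1)) R} (hU : IsUnit U.det)
    {a' : Fin (k + 1) → R} (hcol : (fun i => U i 0) = a') (s₀ : R) (s : Fin k → R) :
    a' ⬝ᵥ felSecret U s₀ s = s₀ := by
  have h : U *ᵥ vecCons 1 0 = a' := by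
    rw [← hcol]
    funext i
    rw [mulVec, dotProduct_comm, cons_dotProduct, one_mul, zero_dotProduct, add_zero]
    rfl
  rw [← h, felSecret, mulVec_dotProduct_felSecret_aux hU, cons_dotProduct_cons, one_mul, zero_dotProduct,
    add_zero]

/-- `v ↦ U v` is a bijection for `U` invertible. [folklore] -/
theorem mulVec_bijective_of_isUnit_det {U : Matrix (Fin (k + 1)) (Fin (k + 1)) R} (hU : IsUnit U.det) :
    Function.Bijective fun v : Fin (k + 1) → R => U *ᵥ v := by
  refine Function.bijective_iff_has_inverse.2 ⟨fun w => U⁻¹ *ᵥ w, fun v => ?_, fun w => ?_⟩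
  · simp only [mulVec_mulVec, nonsing_inv_mul U hU, one_mulVec]
  · simp only [mulVec_mulVec, mul_nonsing_inv U hU, one_mulVec]

/-- `(d, a) ↦ U(d|a)` is a bijection `R × Rᵏ → R^{k+1}` for `U` invertible. [folklore] -/
theorem mulVec_vecCons_bijective {U : Matrix (Fin (k + 1)) (Fin (k + 1)) R} (hU : IsUnit U.det) :
    Function.Bijective fun p : R × (Fin k → R) => U *ᵥ vecCons p.1 p.2 := by
  have h1 : Function.Bijective fun p : R × (Fin k → R) => (vecCons p.1 p.2 : Fin (k + 1) → R) := by
    refine Function.bijective_iff_has_inverse.2 ⟨fun v => (vecHead v, vecTail v), fun p => ?_, fun v => ?_⟩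
    · simp
    · exact cons_head_tail v
  exact (mulVec_bijective_of_isUnit_det hU).comp h1

/-- `(d, (a, b)) ↦ (U(d|a), b + d s₀)` is a bijection
`R × (Rᵏ × R) → R^{k+1} × R` for `U` invertible. [cite: BrakerskiEtAl2013, Lemma 4.3 (proof: uniform samples go to uniform samples)] -/
theorem felSampleMap_bijective {U : Matrix (Fin (k + 1)) (Fin (k + 1)) R} (hU : IsUnit U.det) (s₀ : R) :
    Function.Bijective (felSampleMap U s₀) := by
  -- factor through `(d, a, b) ↦ ((d, a), b + d s₀)` and `((d, a), c) ↦ (U(d|a), c)`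
  let e₁ : R × ((Fin k → R) × R) → (R × (Fin k → R)) × R := fun y => ((y.1, y.2.1), y.2.2 + y.1 * s₀)
  have he₁ : Function.Bijective e₁ := by
    refine Function.bijective_iff_has_inverse.2
      ⟨fun z => (z.1.1, (z.1.2, z.2 - z.1.1 * s₀)), fun y => ?_, fun z => ?_⟩
    · simp [e₁]
    · simp [e₁]
  have he₂ : Function.Bijective fun z : (R × (Fin k → R)) × R => (U *ᵥ vecCons z.1.1 z.1.2, z.2) :=
    ⟨fun z z' h => Prod.ext ((mulVec_vecCons_bijective hU).1 (Prod.ext_iff.1 h).1) (Prod.ext_iff.1 h).2,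
      fun w => by
        obtain ⟨p, hp⟩ := (mulVec_vecCons_bijective hU).2 w.1
        exact ⟨(p, w.2), Prod.ext hp rfl⟩⟩
  exact he₂.comp he₁

end SampleMap

/-! ### One sample: `A_{s,χ}` goes to `A_{s',χ}`, uniform goes to uniform -/

section Single

variable [Fintype R] {k : ℕ}

/-- Mapping a pair `(d, x) ← U_R ⊗ P`: `(pairLaw P).map f = U_R.bind (d ↦ P.map (f (d, ·)))`. [folklore] -/
theorem pairLaw_map {β : Type} (P : PMF ((Fin k → R) × R)) (f : R × ((Fin k → R) × R) → β) :
    (pairLaw P).map f = (PMF.uniformOfFintype R).bind fun d => P.map fun x => f (d, x) := by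
  rw [pairLaw, PMF.map_bind]
  refine congrArg _ (funext fun d => ?_)
  rw [PMF.map_comp]
  rfl

/-- **Lemma 4.3, LWE samples** (one sample, fresh uniform `d`): for `U` invertible, the pair law
`U_R ⊗ A_{s,χ}` is mapped by `(d, (a, b)) ↦ (U(d|a), b + d s₀)` EXACTLY to `A_{s',χ}` with
`s' = (U⁻¹)ᵀ(s₀|s)`: `(d, a) ↦ U(d|a)` is a bijection onto `R^{k+1}` (so the new `a` is uniform) and
`b + d s₀ = ⟨a, s⟩ + e + d s₀ = ⟨U(d|a), s'⟩ + e`. [cite: BrakerskiEtAl2013, Lemma 4.3 (proof)] -/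
theorem pairLaw_lweSample_map_felSampleMap (χ : PMF R) {U : Matrix (Fin (k + 1)) (Fin (k + 1)) R}
    (hU : IsUnit U.det) (s₀ : R) (s : Fin k → R) :
    (pairLaw (lweSample χ s)).map (felSampleMap U s₀) = lweSample χ (felSecret U s₀ s) := by
  -- both sides as `(d, a)` uniform on `R × Rᵏ`, then `e ← χ`
  have lhs : (pairLaw (lweSample χ s)).map (felSampleMap U s₀) =
      (prodLaw (PMF.uniformOfFintype R) (PMF.uniformOfFintype (Fin k → R))).bind fun p =>
        χ.map fun e => (U *ᵥ vecCons p.1 p.2, p.2 ⬝ᵥ s + e + p.1 * s₀) := by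
    rw [pairLaw_map, prodLaw, PMF.bind_bind]
    refine congrArg _ (funext fun d => ?_)
    rw [PMF.bind_map, lweSample, PMF.map_bind]
    refine congrArg _ (funext fun a => ?_)
    rw [PMF.map_comp]
    rfl
  have rhs : lweSample χ (felSecret U s₀ s) =
      (prodLaw (PMF.uniformOfFintype R) (PMF.uniformOfFintype (Fin k → R))).bind fun p =>
        χ.map fun e => (U *ᵥ vecCons p.1 p.2, (U *ᵥ vecCons p.1 p.2) ⬝ᵥ felSecret U s₀ s + e) := by
    rw [lweSample, prodLaw_uniformOfFintype, ← uniformOfFintype_map_of_bijective (mulVec_vecCons_bijective hU),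
      PMF.bind_map]
    rfl
  rw [lhs, rhs]
  refine congrArg _ (funext fun p => ?_)
  congr 1
  funext e
  rw [mulVec_vecCons_dotProduct_felSecret hU]
  ring_nf

/-- **Lemma 4.3, uniform samples** (one sample, fresh uniform `d`): for `U` invertible, the pair law
`U_R ⊗ U_{Rᵏ × R}` is mapped by `(d, (a, b)) ↦ (U(d|a), b + d s₀)` exactly to `U_{R^{k+1} × R}` (a
bijection of finite sets). [cite: BrakerskiEtAl2013, Lemma 4.3 (proof: "given uniform samples, the reduction outputs uniform samples")] -/
theorem pairLaw_uniform_map_felSampleMap {U : Matrix (Fin (k + 1)) (Fin (k + 1)) R} (hU : IsUnit U.det)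
    (s₀ : R) :
    (pairLaw (PMF.uniformOfFintype ((Fin k → R) × R))).map (felSampleMap U s₀) =
      PMF.uniformOfFintype ((Fin (k + 1) → R) × R) := by
  rw [pairLaw_eq_prodLaw, prodLaw_uniformOfFintype]
  exact uniformOfFintype_map_of_bijective (felSampleMap_bijective hU s₀)

end Single

/-! ### `m` samples with independent fresh coins -/

section Blocks

variable [Fintype R] {k : ℕ}

/-- The reduction's treatment of a given tuple of `m` samples: draw `m` independent uniform coins
`d₁, …, d_m` and map sample `j` by `felSampleMap U s₀ (dⱼ, ·)` (a Markov kernel on sample tuples).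
[cite: BrakerskiEtAl2013, Lemma 4.3 (proof: "picking a fresh uniformly random d")] -/
def felCoinsMap (U : Matrix (Fin (k + 1)) (Fin (k + 1)) R) (s₀ : R) (m : ℕ)
    (S : Fin m → (Fin k → R) × R) : PMF (Fin m → (Fin (k + 1) → R) × R) :=
  (iidPMF (PMF.uniformOfFintype R) m).map fun ds j => felSampleMap U s₀ (ds j, S j)

/-- **Fresh independent coins on an iid tuple**: applying `felCoinsMap` to `P^{⊗m}` gives the iid
tuple of the mapped pair law, `((U_R ⊗ P).map (felSampleMap U s₀))^{⊗m}` (zip the independent coin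
tuple with the sample tuple: `prodLaw_iidPMF_map_zip`, then `iidPMF_map`). [folklore] -/
theorem iidPMF_bind_felCoinsMap (U : Matrix (Fin (k + 1)) (Fin (k + 1)) R) (s₀ : R)
    (P : PMF ((Fin k → R) × R)) (m : ℕ) :
    (iidPMF P m).bind (felCoinsMap U s₀ m) = iidPMF ((pairLaw P).map (felSampleMap U s₀)) m := by
  have hzip : (iidPMF P m).bind (felCoinsMap U s₀ m) =
      ((prodLaw (iidPMF (PMF.uniformOfFintype R) m) (iidPMF P m)).map
        (Equiv.arrowProdEquivProdArrow (Fin m) (fun _ => R) (fun _ => (Fin k → R) × R)).symm).map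
        fun x => felSampleMap U s₀ ∘ x := by
    rw [PMF.map_comp, prodLaw, PMF.map_bind]
    simp_rw [PMF.map_comp]
    -- swap the two independent draws
    rw [show (iidPMF P m).bind (felCoinsMap U s₀ m) =
        (iidPMF P m).bind fun S => (iidPMF (PMF.uniformOfFintype R) m).bind fun ds =>
          PMF.pure (fun j => felSampleMap U s₀ (ds j, S j)) from rfl, PMF.bind_comm]
    rfl
  rw [hzip, prodLaw_iidPMF_map_zip, iidPMF_map, pairLaw_eq_prodLaw]

/-- **Block form, LWE world**: `m` samples of `A_{s,χ}` go to `m` samples of `A_{s',χ}`.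
[cite: BrakerskiEtAl2013, Lemma 4.3 (proof)] -/
theorem lweSamples_bind_felCoinsMap (χ : PMF R) {U : Matrix (Fin (k + 1)) (Fin (k + 1)) R}
    (hU : IsUnit U.det) (s₀ : R) (s : Fin k → R) (m : ℕ) :
    (lweSamples χ s m).bind (felCoinsMap U s₀ m) = lweSamples χ (felSecret U s₀ s) m := by
  rw [lweSamples, iidPMF_bind_felCoinsMap, pairLaw_lweSample_map_felSampleMap χ hU, lweSamples]

/-- **Block form, uniform world**: `m` uniform samples go to `m` uniform samples.
[cite: BrakerskiEtAl2013, Lemma 4.3 (proof)] -/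
theorem uniformSamples_bind_felCoinsMap {U : Matrix (Fin (k + 1)) (Fin (k + 1)) R} (hU : IsUnit U.det)
    (s₀ : R) (m : ℕ) :
    (uniformSamples (Fin k) R m).bind (felCoinsMap U s₀ m) = uniformSamples (Fin (k + 1)) R m := by
  rw [uniformSamples_eq_iidPMF_holds, iidPMF_bind_felCoinsMap, pairLaw_uniform_map_felSampleMap hU,
    uniformSamples_eq_iidPMF_holds]

end Blocks

end LWE

end Literature.Computability.Cryptography

end
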